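import Summits.BirchSwinnertonDyer.Rank1Residual.GaloisImage.PropagatedStructureCartesian
import Summits.BirchSwinnertonDyer.Rank1Residual.GaloisImage.PropagatedConditionKummer
import Literature.NumberTheory.EllipticCurves.LocalKummerSequenceSurjective
import Literature.NumberTheory.EllipticCurves.WeilPairingTateDual
import Literature.NumberTheory.GaloisRepresentations.LocalGlobalCohomologyFiniteProofs
import Literature.NumberTheory.GaloisRepresentations.DeformationProfiniteLevel
import HarnessLib

/-!
# The propagated canonical condition `𝓕_can(E[p])_v` through the finite levels:
# `𝓕̄_v = ⋂_N im(H¹(ℚ_v, E[p^{N+1}]) → H¹(ℚ_v, E[p]))`, and its image in `H¹(ℚ_v, E)`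
# (cell `b2b-bsdres`, team n1011, row T-Lp = DISCHARGE of the located local gap (Lp) of the N11
# hypothesis side; seat n1011-p04 gen 5; skeleton `cells/n1011/skel/T-Lp.md` S1–S4)

HONEST FRAMING (cell `b2b-bsdres`, run/shared/lean/b2b/bsd-rank1-residual/, verbatim in every
file): the goal of the cell is to DELETE the COMBINATION-SHAPED residual classes of the
Birch–Swinnerton-Dyer formula for ALL analytic-rank `≤ 1` elliptic curves over `ℚ` — "full BSD
formula for every rank `≤ 1` curve in class `C`" assembled STRICTLY from published theorems — so
that the rank-`≤ 1` remainder becomes exactly the CONSTRUCTION-SHAPED classes, which are TYPED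
(missing-input `Prop`s), NOT attempted. This is not "finishing BSD". Team n1011 (X4 ∧ `p = 3`,
§I N11; row T-a3-F1 = the hypothesis side of Sakamoto 2024 Thm. 4.4 for `(E[3^{k+1}], 𝓕_can)`):
research route; theorems only; no definition, no named fact, no `sorry`; nothing booked; no label
changes.

## What

For `E/ℚ` (`W`, elliptic), a prime `p` and a place `v` of `ℚ`, n1011-p13's propagated canonical
condition `𝓕̄_v = propagatedSelmerStructureOne W p v = im(H¹(ℚ_v, T_pE) → H¹(ℚ_v, E[p]))`
(`PropagatedStructure.lean`; Mazur–Rubin's `𝓕_can` reduced to `E[p]`) is compared with the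
finite levels `red_N : H¹(ℚ_v, E[p^N · p]) → H¹(ℚ_v, E[p])` (`localMap (torsionMulBy (p^N) p)`,
multiplication by `p^N`) and with the change of coefficients
`φ_n : H¹(ℚ_v, E[n]) → X := H¹(ℚ_v, E(ℚ̄_v))` (`galoisCohomology.map (torsionPointsMapIntertwining n ℚ_v) 1`,
kernel = the local Kummer condition, image = `X[n]`):

* `propagatedSelmerStructureOne_le_range_localMap` (S1): `𝓕̄_v ≤ im red_N` for every `N`
  (p13's `induced_propagatedSelmerStructure`);
* `map_torsionPointsMap_localMap_torsionMulBy` (S2): `φ_p (red_N y) = p^N • φ_{p^N·p} y`;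
* `exists_map_torsionPointsMap_eq_pow_smul_of_mem` (S3): for `x ∈ 𝓕̄_v` and every `N`,
  `φ_p x = p^N • c` with `p^{N+1} • c = 0` — the image of `𝓕̄_v` in `X` lies in
  `⋂_N p^N • X[p^{N+1}]` (n1011-p06's (Lℓ) computation, `PropagatedStructureKummerEq.lean`);
* `finite_contOneCocycles_of_finite` : `Z¹_cont(G, M)` is finite when `M` and `H¹_cont(G, M)` are;
* `mem_propagatedSelmerStructureOne_of_forall_mem_range` (S4, Kőnig): at a finite place, a class
  lying in `im red_N` for EVERY `N` lies in `𝓕̄_v` — the sets of continuous crossed homomorphisms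
  `Γ_v → E[p^{N+1}]` reducing to the class are finite (H¹(ℚ_v, E[p^{N+1}]) is finite: tree
  THEOREM `finite_galoisCohomology_one_of_isNonarchimedeanLocalField`, Serre II §5.2 Prop. 14)
  and non-empty, so Kőnig's lemma (Mathlib's `nonempty_sections_of_finite_inverse_system`, through
  the tree's `Deformation.exists_seq_compat_of_finite`) yields a compatible
  tower, i.e. a continuous crossed homomorphism `Γ_v → T_pE`;
* `propagatedSelmerStructureOne_eq_iInf_range` : **`𝓕̄_v = ⨅_N im red_N`** at a finite place.

No hypothesis (any `p`, finite place, reduction type). Consumer: the sibling `PropagatedConditionCard`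
(the count `#𝓕̄_v = #(𝓞_v/p)² · #E(ℚ_v)[p]` from Tate's local Euler–Poincaré characteristic = p13's
binder `hLpIm`). References: Mazur–Rubin, Mem. AMS 799 Def. 3.2.1; Rubin, PCMS 18 §3.1 [Rubin2011];
Sakamoto, JTNB 36 (2024) §2 [Sakamoto2024]; Serre, *Galois Cohomology* I.§2, II.§5.2 Prop. 14
[SerreGaloisCohomology1997]; Silverman, *AEC* III.§7, X.§4 [SilvermanAEC2009].
-/

noncomputable section

open scoped Classical NumberField ContRepresentation
open Field NumberField IsDedekindDomain CategoryTheory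
open WeierstrassCurve Literature.NumberTheory.EllipticCurves Literature.NumberTheory.GaloisRepresentations
  Literature.NumberTheory.GaloisRepresentations.DiscreteGaloisModule

namespace Summit.BirchSwinnertonDyer.Rank1Residual.GaloisImage

/-! ### Finiteness of continuous crossed homomorphisms -/

section FiniteCocycles

variable {G : Type} [Group G] [TopologicalSpace G] [IsTopologicalGroup G] (X : TopRep.{0} ℤ G)

/-- **`Z¹_cont(G, M)` is finite when `M` and `H¹_cont(G, M)` are finite**: each fibre of the class
map `Z¹ → H¹` is a translate of the (finite) set of principal crossed homomorphisms
`g ↦ g v - v`, `v ∈ M` (`oneCocycleClass_eq_zero_iff`). Serre, *Galois Cohomology* I.§2.2, I.§5.1.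
[folklore] -/
theorem finite_contOneCocycles_of_finite [Finite X] (hH : Finite (continuousCohomology 1 X)) :
    Finite (contOneCocycles X) := by
  let e : contOneCocycles X → (G → X) := fun φ => ⇑φ.1
  have he : Function.Injective e := fun φ ψ h => Subtype.ext (ContinuousMap.ext fun g => congrFun h g)
  have hfib : ∀ c : continuousCohomology 1 X,
      Set.Finite {φ : contOneCocycles X | oneCocycleClass X φ = c} := by
    intro c
    by_cases hc : ∃ φ₀ : contOneCocycles X, oneCocycleClass X φ₀ = c
    · obtain ⟨φ₀, hφ₀⟩ := hc
      let R : Set (G → X) := Set.range fun v : X => fun g => φ₀.1 g + (X.ρ g v - v)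
      have hR : R.Finite := Set.finite_range _
      refine ((hR.preimage he.injOn).subset ?_)
      intro φ hφ
      have h0 : oneCocycleClass X (φ - φ₀) = 0 := by
        rw [oneCocycleClass_sub, hφ₀]; exact sub_eq_zero.mpr hφ
      obtain ⟨v, hv⟩ := (oneCocycleClass_eq_zero_iff X _).mp h0
      refine ⟨v, funext fun g => ?_⟩
      have h := hv g
      rw [Submodule.coe_sub, ContinuousMap.sub_apply, sub_eq_iff_eq_add'] at h
      exact h.symm
    · convert Set.finite_empty
      ext φ
      simp only [Set.mem_setOf_eq, Set.mem_empty_iff_false, iff_false]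
      exact fun h => hc ⟨φ, h⟩
  have huniv : (Set.univ : Set (contOneCocycles X)).Finite := by
    have : (Set.univ : Set (contOneCocycles X)) =
        ⋃ c : continuousCohomology 1 X, {φ | oneCocycleClass X φ = c} := by
      ext φ; simp
    rw [this]
    exact Set.finite_iUnion hfib
  exact Set.finite_univ_iff.mp huniv

end FiniteCocycles

variable (W : WeierstrassCurve ℚ) [W.IsElliptic] (p : ℕ) [hp : Fact p.Prime]

/-! ### S1. `𝓕̄_v ≤ im(H¹(ℚ_v, E[p^N·p]) → H¹(ℚ_v, E[p]))` for every `N` -/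

/-- **(S1) `𝓕_can(E[p])_v ≤ im red_N`** for every level `N`: the propagated condition on `E[p]` is
the image under `red_N = [p^N]_*` of the propagated condition on `E[p^N·p]` (p13's
`induced_propagatedSelmerStructure`). [cite: Sakamoto2024, §2 (p. 921), the induced Selmer structure] -/
theorem propagatedSelmerStructureOne_le_range_localMap (N : ℕ) (v : Place ℚ) :
    propagatedSelmerStructureOne W p v ≤
      (DiscreteGaloisModule.localMap (W.torsionMulBy ((p : ℤ) ^ N) (p : ℤ)) v).range := by
  intro x hx
  rw [← induced_propagatedSelmerStructure W p N] at hx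
  obtain ⟨y, -, rfl⟩ := (SelmerStructure.mem_induced_iff _ _ v x).mp hx
  exact ⟨y, rfl⟩

/-! ### S2. Compatibility with the change of coefficients to `E(ℚ̄_v)` -/

omit [W.IsElliptic] hp in
/-- **(S2) `φ_p (red_N y) = p^N • φ_{p^N·p} y`** in `X = H¹(ℚ_v, E(ℚ̄_v))`: changing coefficients
to the local points after multiplying the level-`p^N·p` class by `p^N` is `p^N` times changing
coefficients directly (on crossed homomorphisms: `pointsMap (p^N • ψ g) = p^N • pointsMap (ψ g)`).
Silverman, *AEC* X.§4 (the Kummer diagram at two levels). [folklore] -/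
theorem map_torsionPointsMap_localMap_torsionMulBy (N : ℕ) (v : Place ℚ)
    (y : galoisCohomology ((W.torsionGaloisModule ((p : ℤ) ^ N * (p : ℤ))).toLocal v) 1) :
    galoisCohomology.map (W.torsionPointsMapIntertwining (p : ℤ) (Place.Completion v)) 1
        (DiscreteGaloisModule.localMap (W.torsionMulBy ((p : ℤ) ^ N) (p : ℤ)) v y) =
      ((p ^ N : ℕ) : ℤ) • galoisCohomology.map
        (W.torsionPointsMapIntertwining ((p : ℤ) ^ N * (p : ℤ)) (Place.Completion v)) 1 y := by
  set F := Place.Completion v with hF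
  obtain ⟨ψ, rfl⟩ := oneCocycleClass_surjective
    ((W.torsionGaloisModule ((p : ℤ) ^ N * (p : ℤ))).toLocal v).toTopRep y
  rw [localMap_torsionMulBy_oneCocycleClass]
  have h1 := W.map_torsionPointsMapIntertwining_oneCocycleClass (p : ℤ) F (redCocycle W p N v ψ)
  have hN := W.map_torsionPointsMapIntertwining_oneCocycleClass ((p : ℤ) ^ N * (p : ℤ)) F ψ
  erw [h1, hN]
  set Y : TopRep ℤ (absoluteGaloisGroup F) := discreteTopRep (absoluteGaloisGroup F) (localPoints W F)
    with hY
  set c₁ := contOneCocycles.pullback (ContinuousMonoidHom.id (absoluteGaloisGroup F))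
      (X := DiscreteGaloisModule.toTopRep (GaloisRep.restrictField F (W.torsionGaloisModule (p : ℤ))))
      (Y := Y)
      (TopRep.ofHom ⟨(W.torsionPointsMapIntertwining (p : ℤ) F).toContinuousLinearMap,
        (W.torsionPointsMapIntertwining (p : ℤ) F).isIntertwining'⟩) (redCocycle W p N v ψ)
    with hc₁
  set cN := contOneCocycles.pullback (ContinuousMonoidHom.id (absoluteGaloisGroup F))
      (X := DiscreteGaloisModule.toTopRep
        (GaloisRep.restrictField F (W.torsionGaloisModule ((p : ℤ) ^ N * (p : ℤ)))))
      (Y := Y)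
      (TopRep.ofHom ⟨(W.torsionPointsMapIntertwining ((p : ℤ) ^ N * (p : ℤ)) F).toContinuousLinearMap,
        (W.torsionPointsMapIntertwining ((p : ℤ) ^ N * (p : ℤ)) F).isIntertwining'⟩) ψ
    with hcN
  have hc₁_apply : ∀ g, c₁.1 g =
      pointsMap W F (((redCocycle W p N v ψ).1 g : geomTorsion W (p : ℤ)) : geomPoints W) :=
    fun g => rfl
  have hcN_apply : ∀ g, cN.1 g =
      pointsMap W F ((ψ.1 g : geomTorsion W ((p : ℤ) ^ N * (p : ℤ))) : geomPoints W) :=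
    fun g => rfl
  -- `c₁ = p^N • cN`
  have hrel : c₁ = ((p ^ N : ℕ) : ℤ) • cN := by
    refine Subtype.ext (ContinuousMap.ext fun g => ?_)
    change c₁.1 g = ((p ^ N : ℕ) : ℤ) • cN.1 g
    rw [hc₁_apply, hcN_apply, coe_redCocycle_apply, map_zsmul, Nat.cast_pow]
  have hmod : _ := congrArg (oneCocycleClass Y) hrel
  rw [oneCocycleClass_smul] at hmod
  rw [hmod]
  exact int_smul_eq_zsmul (continuousCohomology 1 Y).toModuleCat.isModule _ _

/-! ### S3. The image of `𝓕̄_v` in `H¹(ℚ_v, E)` lies in `⋂_N p^N • X[p^{N+1}]` -/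

/-- **(S3)** For `x ∈ 𝓕_can(E[p])_v` and every `N`, the image of `x` in `X = H¹(ℚ_v, E(ℚ̄_v))` is
`p^N • c` for a class `c` with `p^{N+1} • c = 0` (namely `c = φ_{p^N·p} y` for a level-`p^N·p` lift
`y` of `x`): the image of `𝓕̄_v` lies in `p^N • X[p^{N+1}]` for every `N` (n1011-p06's (Lℓ)
computation, `PropagatedStructureKummerEq.lean`). [cite: Rubin2011, §3.1 (p. 29)] -/
theorem exists_map_torsionPointsMap_eq_pow_smul_of_mem (N : ℕ) (v : Place ℚ)
    {x : galoisCohomology ((W.torsionGaloisModule (p : ℤ)).toLocal v) 1}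
    (hx : x ∈ propagatedSelmerStructureOne W p v) :
    ∃ c : galoisCohomology (W.localGaloisModule (Place.Completion v)) 1,
      ((p ^ (N + 1) : ℕ) : ℤ) • c = 0 ∧
      galoisCohomology.map (W.torsionPointsMapIntertwining (p : ℤ) (Place.Completion v)) 1 x =
        ((p ^ N : ℕ) : ℤ) • c := by
  obtain ⟨y, rfl⟩ := propagatedSelmerStructureOne_le_range_localMap W p N v hx
  refine ⟨galoisCohomology.map
      (W.torsionPointsMapIntertwining ((p : ℤ) ^ N * (p : ℤ)) (Place.Completion v)) 1 y, ?_,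
    map_torsionPointsMap_localMap_torsionMulBy W p N v y⟩
  have h := W.zsmul_map_torsionPointsMapIntertwining (Place.Completion v) (n := (p : ℤ) ^ N * (p : ℤ)) y
  have hcast : ((p ^ (N + 1) : ℕ) : ℤ) = (p : ℤ) ^ N * (p : ℤ) := by push_cast; ring
  rw [hcast]
  exact h


/-! ### S4. Kőnig: a class lying in `im red_N` for every `N` lies in `𝓕̄_v` -/

/-- **(S4) `⋂_N im red_N ≤ 𝓕_can(E[p])_v` at a finite place** (the reverse of S1).  If
`x ∈ H¹(ℚ_v, E[p])` is, for every `N`, the reduction of a class of `H¹(ℚ_v, E[p^N·p])`, then `x` is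
the reduction of a class of `H¹(ℚ_v, T_pE)`, i.e. `x ∈ 𝓕̄_v`.  Proof: the set `S_N` of continuous
crossed homomorphisms `Γ_v → E[p^N·p]` whose reduction represents `x` is finite
(`finite_contOneCocycles_of_finite`; `H¹(ℚ_v, E[p^N·p])` is finite, tree THEOREM
`finite_galoisCohomology_one_of_isNonarchimedeanLocalField`) and non-empty; multiplication by `p`
maps `S_{N+1} → S_N`; Kőnig's lemma (tree `Deformation.exists_seq_compat_of_finite`) gives a compatible
tower `(φ_N)_N`, `p • φ_{N+1} = φ_N`, i.e. a continuous crossed homomorphism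
`η = (φ_N)_N : Γ_v → T_pE = lim E[p^n]` with `π_1 ∘ η = φ_0`, so `x = π_{1,*}[η]`.
Serre, *Galois Cohomology* I.§2.2 (cocycles), II.§5.2 Prop. 14 (finiteness); Silverman, *AEC*
III.§7 (the Tate module as compatible sequences). [cite: SerreGaloisCohomology1997, II §5.2 Prop. 14] -/
theorem mem_propagatedSelmerStructureOne_of_forall_mem_range (v : HeightOneSpectrum (𝓞 ℚ))
    {x : galoisCohomology ((W.torsionGaloisModule (p : ℤ)).toLocal (Sum.inr v : Place ℚ)) 1}
    (hx : ∀ N : ℕ, x ∈ (DiscreteGaloisModule.localMap (W.torsionMulBy ((p : ℤ) ^ N) (p : ℤ))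
      (Sum.inr v : Place ℚ)).range) :
    x ∈ propagatedSelmerStructureOne W p (Sum.inr v) := by
  -- the modules `M_N = E[p^N·p]`, their local representations, the residual one
  let M : ℕ → Type := fun N => geomTorsion W ((p : ℤ) ^ N * (p : ℤ))
  let X : ℕ → TopRep ℤ (absoluteGaloisGroup (Place.Completion (Sum.inr v : Place ℚ))) := fun N =>
    ((W.torsionGaloisModule ((p : ℤ) ^ N * (p : ℤ))).toLocal (Sum.inr v : Place ℚ)).toTopRep
  let X₁ : TopRep ℤ (absoluteGaloisGroup (Place.Completion (Sum.inr v : Place ℚ))) :=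
    ((W.torsionGaloisModule (p : ℤ)).toLocal (Sum.inr v : Place ℚ)).toTopRep
  -- finiteness of the cocycle groups
  have hfinM : ∀ N, Finite (M N) := fun N => by
    have hc : ((p : ℤ) ^ N * (p : ℤ)) = ((p ^ (N + 1) : ℕ) : ℤ) := by push_cast; ring
    show Finite (geomTorsion W ((p : ℤ) ^ N * (p : ℤ)))
    rw [hc]
    haveI : NeZero (p ^ (N + 1)) := ⟨pow_ne_zero _ hp.out.ne_zero⟩
    exact finite_geomTorsion_of_neZero W (p ^ (N + 1))
  have hZfin : ∀ N, Finite (contOneCocycles (X N)) := fun N => by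
    -- local-field instances on `ℚ_v = Place.Completion (inr v)` (definitionally `v.adicCompletion ℚ`)
    letI : ValuativeRel (Place.Completion (Sum.inr v : Place ℚ)) :=
      (inferInstance : ValuativeRel (v.adicCompletion ℚ))
    letI : TopologicalSpace (Place.Completion (Sum.inr v : Place ℚ)) :=
      (inferInstance : TopologicalSpace (v.adicCompletion ℚ))
    haveI : IsNonarchimedeanLocalField (Place.Completion (Sum.inr v : Place ℚ)) :=
      (inferInstance : IsNonarchimedeanLocalField (v.adicCompletion ℚ))
    haveI : CharZero (Place.Completion (Sum.inr v : Place ℚ)) := charZero_adicCompletion v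
    haveI : Finite (X N) := hfinM N
    exact finite_contOneCocycles_of_finite (X N)
      (finite_galoisCohomology_one_of_isNonarchimedeanLocalField
        ((W.torsionGaloisModule ((p : ℤ) ^ N * (p : ℤ))).toLocal (Sum.inr v : Place ℚ)))
  -- the fibres over `x`
  let S : ℕ → Type := fun N =>
    {φ : contOneCocycles (X N) // oneCocycleClass X₁ (redCocycle W p N (Sum.inr v) φ) = x}
  haveI : ∀ N, Finite (S N) := fun N => by haveI := hZfin N; exact Subtype.finite
  haveI : ∀ N, Nonempty (S N) := fun N => by
    obtain ⟨y, hy⟩ := hx N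
    obtain ⟨φ, rfl⟩ := oneCocycleClass_surjective (X N) y
    exact ⟨⟨φ, by
      rw [← hy]; exact (localMap_torsionMulBy_oneCocycleClass W p N (Sum.inr v) φ).symm⟩⟩
  -- multiplication by `p` on crossed homomorphisms, level `N+2` → level `N+1`
  have hmem : ∀ N (P : M (N + 1)), (p : ℤ) • (P : geomPoints W) ∈
      geomTorsion W ((p : ℤ) ^ N * (p : ℤ)) := by
    intro N P
    rw [mem_geomTorsion_iff, smul_smul]
    have hP := (mem_geomTorsion_iff W _ _).mp P.2
    have hc : (p : ℤ) ^ N * (p : ℤ) * (p : ℤ) = (p : ℤ) ^ (N + 1) * (p : ℤ) := by ring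
    rw [hc]
    exact hP
  let mulP : ∀ N, contOneCocycles (X (N + 1)) → contOneCocycles (X N) := fun N φ =>
    ⟨⟨fun g => (⟨(p : ℤ) • ((φ.1 g : M (N + 1)) : geomPoints W), hmem N (φ.1 g)⟩ : M N),
      (continuous_of_discreteTopology (f := fun P : M (N + 1) =>
        (⟨(p : ℤ) • (P : geomPoints W), hmem N P⟩ : M N))).comp φ.1.continuous⟩,
     fun g h => by
      apply Subtype.ext
      change (p : ℤ) • ((φ.1 (g * h) : M (N + 1)) : geomPoints W) =
        (p : ℤ) • ((φ.1 g : M (N + 1)) : geomPoints W) +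
          absGaloisRestrict ℚ (Place.Completion (Sum.inr v : Place ℚ)) g •
            ((p : ℤ) • ((φ.1 h : M (N + 1)) : geomPoints W))
      rw [φ.2 g h]
      change (p : ℤ) • (((φ.1 g : M (N + 1)) : geomPoints W) +
          absGaloisRestrict ℚ (Place.Completion (Sum.inr v : Place ℚ)) g •
            ((φ.1 h : M (N + 1)) : geomPoints W)) = _
      rw [smul_add, W.smul_zsmul_geomPoints (p : ℤ)]⟩
  have mulP_coe : ∀ N (φ : contOneCocycles (X (N + 1)))
      (g : absoluteGaloisGroup (Place.Completion (Sum.inr v : Place ℚ))),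
      (((mulP N φ).1 g : M N) : geomPoints W) = (p : ℤ) • ((φ.1 g : M (N + 1)) : geomPoints W) :=
    fun N φ g => rfl
  -- `mulP` maps the fibre `S_{N+1}` to the fibre `S_N`
  have hred : ∀ N (φ : contOneCocycles (X (N + 1))),
      redCocycle W p N (Sum.inr v) (mulP N φ) = redCocycle W p (N + 1) (Sum.inr v) φ := by
    intro N φ
    refine Subtype.ext (ContinuousMap.ext fun g => Subtype.ext ?_)
    rw [coe_redCocycle_apply, coe_redCocycle_apply, mulP_coe, smul_smul, ← pow_succ]
  let f : ∀ N, S (N + 1) → S N := fun N φ => ⟨mulP N φ.1, by rw [hred]; exact φ.2⟩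
  -- Kőnig
  obtain ⟨s, hs⟩ := Deformation.exists_seq_compat_of_finite (S := S) f
  have hs' : ∀ k (g : absoluteGaloisGroup (Place.Completion (Sum.inr v : Place ℚ))),
      (p : ℤ) • (((s (k + 1)).1.1 g : M (k + 1)) : geomPoints W) =
        (((s k).1.1 g : M k) : geomPoints W) := by
    intro k g
    have h := congrArg (fun φ : S k => ((φ.1.1 g : M k) : geomPoints W)) (hs k)
    exact (mulP_coe k (s (k + 1)).1 g).symm.trans h
  -- the compatible tower as a `T_pE`-valued function
  let a : absoluteGaloisGroup (Place.Completion (Sum.inr v : Place ℚ)) → ℕ → geomPoints W :=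
    fun g n => match n with
      | 0 => 0
      | k + 1 => (((s k).1.1 g : M k) : geomPoints W)
  have ha0 : ∀ g, a g 0 = 0 := fun g => rfl
  have ha1 : ∀ g k, a g (k + 1) = (((s k).1.1 g : M k) : geomPoints W) := fun g k => rfl
  have htor : ∀ g n, p ^ n • a g n = 0 := by
    intro g n
    cases n with
    | zero => simp only [ha0, smul_zero]
    | succ k =>
      rw [ha1, ← natCast_zsmul]
      have hP := (mem_geomTorsion_iff W _ _).mp ((s k).1.1 g).2
      have hc : ((p ^ (k + 1) : ℕ) : ℤ) = (p : ℤ) ^ k * (p : ℤ) := by push_cast; ring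
      rw [hc]
      exact hP
  have hcompat : ∀ g n, p • a g (n + 1) = a g n := by
    intro g n
    cases n with
    | zero =>
      simp only [ha0, ha1, ← natCast_zsmul]
      have hP := (mem_geomTorsion_iff W _ _).mp ((s 0).1.1 g).2
      have hc : (p : ℤ) ^ 0 * (p : ℤ) = (p : ℤ) := by ring
      exact (congrArg (fun c : ℤ => c • (((s 0).1.1 g : M 0) : geomPoints W)) hc).symm.trans hP
    | succ k => simp only [ha1, ← natCast_zsmul]; exact hs' k g
  let η₀ : absoluteGaloisGroup (Place.Completion (Sum.inr v : Place ℚ)) → W.tateModule p := fun g =>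
    TateModule.mk (a g) (htor g) (hcompat g)
  have hη₀_proj : ∀ g n, TateModule.proj p n (η₀ g) = a g n := fun g n => rfl
  have hcont : Continuous η₀ := by
    have hpi : Continuous fun g : absoluteGaloisGroup (Place.Completion (Sum.inr v : Place ℚ)) => a g := by
      refine continuous_pi fun n => ?_
      cases n with
      | zero => exact continuous_const
      | succ k =>
        show Continuous fun g => (((s k).1.1 g : M k) : geomPoints W)
        exact continuous_subtype_val.comp (s k).1.1.continuous
    exact hpi.subtype_mk _
  have hcoc : ∀ g h, η₀ (g * h) = η₀ g + (tateLocalRep W p (Sum.inr v : Place ℚ)).toTopRep.ρ g (η₀ h) := by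
    intro g h
    refine TateModule.ext fun n => ?_
    rw [map_add, ContinuousRep.toTopRep_ρ_apply, tateLocalRep_apply_apply,
      TateModule.proj_smul_of_distribMulAction, hη₀_proj, hη₀_proj, hη₀_proj]
    cases n with
    | zero => simp only [ha0, smul_zero, add_zero]
    | succ k =>
      simp only [ha1]
      exact congrArg (fun P : M k => (P : geomPoints W)) ((s k).1.2 g h)
  let η : contOneCocycles (tateLocalRep W p (Sum.inr v : Place ℚ)).toTopRep := ⟨⟨η₀, hcont⟩, hcoc⟩
  -- `π_1 ∘ η = φ_0`
  have hpush : pushCocycleOne W p (Sum.inr v : Place ℚ) η = redCocycle W p 0 (Sum.inr v) (s 0).1 := by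
    refine Subtype.ext (ContinuousMap.ext fun g => Subtype.ext ?_)
    rw [coe_redCocycle_apply]
    change TateModule.proj p 1 (η₀ g) = _
    rw [hη₀_proj, ha1]
    exact (one_smul ℤ _).symm.trans
      (congrArg (fun c : ℤ => c • (((s 0).1.1 g : M 0) : geomPoints W)) (pow_zero (p : ℤ)).symm)
  refine (mem_propagatedSelmerStructureOne_iff W p (Sum.inr v) x).mpr
    ⟨oneCocycleClass (tateLocalRep W p (Sum.inr v : Place ℚ)).toTopRep η, ?_⟩
  rw [tateLocalMapOne_oneCocycleClass, hpush]
  exact (s 0).2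

/-- **`𝓕_can(E[p])_v = ⨅_N im(H¹(ℚ_v, E[p^N·p]) → H¹(ℚ_v, E[p]))` at a finite place** (S1 + S4):
the propagated canonical condition on the residual representation is exactly the set of classes
liftable to every finite level. Mazur–Rubin, Mem. AMS 799 Def. 3.2.1 (propagation from `T`);
Rubin, PCMS 18 §3.1. [cite: Rubin2011, §3.1 (p. 29)] -/
theorem propagatedSelmerStructureOne_eq_iInf_range (v : HeightOneSpectrum (𝓞 ℚ)) :
    propagatedSelmerStructureOne W p (Sum.inr v) =
      ⨅ N : ℕ, (DiscreteGaloisModule.localMap (W.torsionMulBy ((p : ℤ) ^ N) (p : ℤ))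
        (Sum.inr v : Place ℚ)).range := by
  refine le_antisymm (le_iInf fun N => propagatedSelmerStructureOne_le_range_localMap W p N _)
    fun x hx => ?_
  exact mem_propagatedSelmerStructureOne_of_forall_mem_range W p v
    fun N => (AddSubgroup.mem_iInf.mp hx) N

end Summit.BirchSwinnertonDyer.Rank1Residual.GaloisImage

end
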